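import Summits.Ventures.Crystal3D.Theorems.StickyWulffConstantTextureLiminfTexShadowAtGlueV5
import Summits.Ventures.Crystal3D.Theorems.StickyWulffConstantCoaxialWallLawLedgerWithCharge
import HarnessLib

/-!
# TexShadow at LAW v5 — the BRIDGE from lane G's uniform charge-`c₀` wall ledger to T's `BothFcc` cells at cap `c₀`
# (T-V5 PORT, towards P5 `betaIIIAt_of_coverage`; lane T, crux `TextureLiminfV5`, stmt-Ventures-23912; cf-p1 g30 memo HOME/cf-p1/T-V5-PORT.md P5)

HONEST FRAMING. Venture `Summits/Ventures/Crystal3D` (cell `crystal3d-full`), route `route-Ventures-StickyWulffConstant`, helper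
`--supports` the law-v5 crux `TextureLiminfV5` (stmt-Ventures-23912).  Pure bookkeeping (census-free, standard axioms).  Lane G's
law-v5 statement is a HYPOTHESIS here (`hG`), in the explicit-constant currency of the restatement programme
(`TwoSlabLedgerWith K R₀ c₀`, …CoaxialWallLawLedgerWithDefs p681268; `GenericWallFloorWithCharge K R₀ c₀`, …LedgerWithCharge p681705):
«every NON-co-axial pair of affine fcc lattices satisfies the clamped-cylinder cell with charge `c₀` at ONE `(K, R₀)`» — the uniform
form of lane G's `genericWallFloorAtCharge_all_of_coverage` that 19480-p2's generic cone delivers (`genericWallFloorWithCharge_all_of_coverage`,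
in flight).  Nothing about that statement is proved here; rung F-C1 not moved.

THE POINT.  For a `BothFcc` presented plate pair every bilayer frame `(A₁ i, u₁ i)` spans the plate's own affine fcc lattice
(`bilayerFrame_affine_eq`), and a charge table admissible AT CAP `c₀` charges the unit slice at most `c₀·πρ²` (`tsum_charge_le_cap`);
so lane G's adhesion-form cell with charge `c₀` for the two affine plates IS T's cell inequality for every `c₀`-admissible table
(`bilayerWallAt_of_adhesionAt`, the inner-face count bridge of …TexShadowInnerFaceCount).  Hence, from `hG`:
* `bilayerWallAt_of_ledgerWith_cap` — one presented pair: `TwoSlabLedgerWith K R₀ c₀` for its affine plates + a `c₀`-capped table ⇒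
  `BilayerWallAt (K + 60√2π) R₀ …`;
* `bilayerWallAt_bothFcc_nonCoaxial_of_ledgerWith` — every `BothFcc` pair with SOME non-co-axial bilayer-frame pair `(A₁ i, A₂ j)`;
* **`betaIIIAt_of_ledgerWith : hG → BilayerWallBetaIIIAt c₀ (K + 60√2π) R₀`** (the (β-iii) stub of TexShadow v7 at cap `c₀`; the seven-cell
  hypothesis is not even used — at law v5 lane G prices ALL non-co-axial pairs at `c₀`), and the `GenericWallFloorWithCharge`-currency form
  **`betaIIIAt_of_withCharge : hG' → ∃ C, BilayerWallBetaIIIAt c₀ C R₀`** (through `twoSlabLedgerWith_of_withCharge`);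
* `bilayerWallAt_bothFcc_residual_of_ledgerWith` — the `BothFcc` part of the registered residual at cap `c₀` (a residual-class frame pair is
  affinely non-co-axial): the (β-iii)/residual MERGE of cf-p1 (lxvii) on `BothFcc` pairs;
* `bilayerWallAt_of_bothFcc_ledgerWith` — the whole `BothFcc` dispatcher at cap `c₀ ≤ 1` from F-U + `hG` alone (zero cell / F-U /
  `hG`; no E1, no `StarPairFar`, no `hgen`, no cell sort).
WHAT REMAINS for P5 as the memo states it: (a) lane G's uniform With-closer (owner 19480-p2 g10); (b) the residual stub
`∃ C, BilayerWallResidualAt c₀ C R₀` quantifies over ALL Barlow plate pairs — its FAULTED part (`¬BothFcc`, some bilayer-frame pair in the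
residual class) is NOT an instance of a two-fcc-lattice statement and is not touched here (flagged to cf-p1).
WHAT THIS IS NOT: no proof of lane G's law at any charge; F-C1 not moved.
-/

noncomputable section

namespace Summit.Ventures.Crystal3D.Cruxes.TextureLiminf.TexShadow

open Summit.Ventures.Crystal3D Summit.Ventures.Crystal3D.Theorems
open Literature.MathematicalPhysics.StatisticalMechanics (IsHaggSeq fccStacking barlowStacking)
open scoped InnerProductSpace

/-- Affinely co-axial fcc lattices `(P₁· + t₁) '' Λ₀`, `(P₂· + t₂) '' Λ₀` (a common moved Barlow frame) have co-axial linear parts. -/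
theorem coAx_of_affine_coax {P₁ P₂ : E3 ≃ₗᵢ[ℝ] E3} {t₁ t₂ : E3}
    (h : ∃ (L : E3 ≃ₗᵢ[ℝ] E3) (r₁ r₂ : E3) (σ σ' : ℤ → ℤ), IsHaggSeq σ ∧ IsHaggSeq σ' ∧
      (fun p => P₁ p + t₁) '' fccStacking 1 (Real.sqrt (2 / 3)) ⊆
        (fun p => L p + r₁) '' barlowStacking 1 (Real.sqrt (2 / 3)) σ ∧
      (fun p => P₂ p + t₂) '' fccStacking 1 (Real.sqrt (2 / 3)) ⊆
        (fun p => L p + r₂) '' barlowStacking 1 (Real.sqrt (2 / 3)) σ') :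
    CoAx P₁ P₂ := by
  obtain ⟨L, r₁, r₂, σ, σ', hσ, hσ', h₁, h₂⟩ := h
  exact ⟨L e₃, L, r₁ - t₁, r₂ - t₂, σ, σ', hσ, hσ', rfl,
    (image_fccRef_subset_barlow_iff_affine P₁ L t₁ r₁ σ).1 h₁,
    (image_fccRef_subset_barlow_iff_affine P₂ L t₂ r₂ σ').1 h₂⟩

/-- **Lane G's charge-`c₀` cell IS T's cell for `c₀`-capped tables.**  For a presented pair with affine plate lattices
`(Pₖ· + sₖ) '' Λ₀`, a table with `0 ≤ c ≤ c₀` (`c₀ ≥ 0`) and lane G's adhesion-form cell `TwoSlabLedgerWith K R₀ c₀ P₁ s₁ P₂ s₂` (`R₀ ≥ 1`):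
`BilayerWallAt (K + 60√2π) R₀ σ₁ σ₂ L₁ L₂ s₁ s₂ c` (the slice charge is `≤ c₀·πρ²` by `tsum_charge_le_cap`; then `bilayerWallAt_of_adhesionAt`). -/
theorem bilayerWallAt_of_ledgerWith_cap {σ₁ σ₂ : ℤ → ℤ} {L₁ L₂ P₁ P₂ : E3 ≃ₗᵢ[ℝ] E3} {s₁ s₂ : E3}
    (hS₁ : stacking L₁ s₁ σ₁ = (fun q => P₁ q + s₁) '' fccStacking 1 (Real.sqrt (2 / 3)))
    (hS₂ : stacking L₂ s₂ σ₂ = (fun q => P₂ q + s₂) '' fccStacking 1 (Real.sqrt (2 / 3)))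
    {c : ℤ → ℤ → ℝ} {c₀ K R₀ : ℝ} (hc₀ : 0 ≤ c₀) (hR₀ : 1 ≤ R₀) (hc0 : ∀ i j, 0 ≤ c i j) (hc1 : ∀ i j, c i j ≤ c₀)
    (hL : TwoSlabLedgerWith K R₀ c₀ P₁ s₁ P₂ s₂) :
    BilayerWallAt (K + 60 * Real.sqrt 2 * Real.pi) R₀ σ₁ σ₂ L₁ L₂ s₁ s₂ c :=
  bilayerWallAt_of_adhesionAt hS₁ hS₂ hR₀
    (fun ρ hρ => tsum_charge_le_cap L₁ L₂ s₁ s₂ c hc₀ hc0 hc1 (by linarith)) hL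

/-- **Every `BothFcc` pair with a NON-co-axial bilayer-frame pair satisfies the cell at cap `c₀`**, given lane G's uniform charge-`c₀`
ledger `hG` for all affinely non-co-axial pairs of affine fcc lattices at `(K, R₀)`. -/
theorem bilayerWallAt_bothFcc_nonCoaxial_of_ledgerWith {c₀ K R₀ : ℝ} (hc₀ : 0 ≤ c₀) (hR₀ : 1 ≤ R₀)
    (hG : ∀ (P₁ : E3 ≃ₗᵢ[ℝ] E3) (t₁ : E3) (P₂ : E3 ≃ₗᵢ[ℝ] E3) (t₂ : E3),
      ¬ (∃ (L : E3 ≃ₗᵢ[ℝ] E3) (r₁ r₂ : E3) (σ σ' : ℤ → ℤ), IsHaggSeq σ ∧ IsHaggSeq σ' ∧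
        (fun p => P₁ p + t₁) '' fccStacking 1 (Real.sqrt (2 / 3)) ⊆
          (fun p => L p + r₁) '' barlowStacking 1 (Real.sqrt (2 / 3)) σ ∧
        (fun p => P₂ p + t₂) '' fccStacking 1 (Real.sqrt (2 / 3)) ⊆
          (fun p => L p + r₂) '' barlowStacking 1 (Real.sqrt (2 / 3)) σ') →
      TwoSlabLedgerWith K R₀ c₀ P₁ t₁ P₂ t₂)
    {σ₁ σ₂ : ℤ → ℤ} (hσ₁ : IsHaggSeq σ₁) (hσ₂ : IsHaggSeq σ₂) (hfcc : BothFcc σ₁ σ₂)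
    (L₁ L₂ : E3 ≃ₗᵢ[ℝ] E3) (s₁ s₂ : E3) {A₁ A₂ : ℤ → (E3 ≃ₗᵢ[ℝ] E3)} {u₁ u₂ : ℤ → E3}
    (hfr₁ : BilayerFramesAt L₁ s₁ σ₁ A₁ u₁) (hfr₂ : BilayerFramesAt L₂ s₂ σ₂ A₂ u₂)
    {c : ℤ → ℤ → ℝ} {m : ℤ → ℤ → E3} (hadm : BilayerChargeAdmissibleAt c₀ A₁ A₂ c m)
    {i j : ℤ} (hnc : ¬ CoAx (A₁ i) (A₂ j)) :
    BilayerWallAt (K + 60 * Real.sqrt 2 * Real.pi) R₀ σ₁ σ₂ L₁ L₂ s₁ s₂ c := by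
  obtain ⟨P₁, P₂, -, -, hS₁, hS₂⟩ := exists_affine_fcc_pair_of_bothFcc L₁ L₂ s₁ s₂ hσ₁ hσ₂ hfcc
  have hnc' : ¬ CoAx P₁ P₂ := by
    rw [← coAx_congr (bilayerFrame_image_eq hσ₁ hS₁ hfr₁ i) (bilayerFrame_image_eq hσ₂ hS₂ hfr₂ j)]; exact hnc
  exact bilayerWallAt_of_ledgerWith_cap hS₁ hS₂ hc₀ hR₀ hadm.1 hadm.2.1
    (hG P₁ s₁ P₂ s₂ fun h => hnc' (coAx_of_affine_coax h))

/-- **The (β-iii) stub of TexShadow v7 at cap `c₀`, from lane G's uniform charge-`c₀` ledger** (constant `K + 60√2π`; the seven-cell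
hypothesis of the carve-out is not used — at law v5 lane G prices ALL non-co-axial pairs at `c₀`). -/
theorem betaIIIAt_of_ledgerWith {c₀ K R₀ : ℝ} (hc₀ : 0 ≤ c₀) (hR₀ : 1 ≤ R₀)
    (hG : ∀ (P₁ : E3 ≃ₗᵢ[ℝ] E3) (t₁ : E3) (P₂ : E3 ≃ₗᵢ[ℝ] E3) (t₂ : E3),
      ¬ (∃ (L : E3 ≃ₗᵢ[ℝ] E3) (r₁ r₂ : E3) (σ σ' : ℤ → ℤ), IsHaggSeq σ ∧ IsHaggSeq σ' ∧
        (fun p => P₁ p + t₁) '' fccStacking 1 (Real.sqrt (2 / 3)) ⊆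
          (fun p => L p + r₁) '' barlowStacking 1 (Real.sqrt (2 / 3)) σ ∧
        (fun p => P₂ p + t₂) '' fccStacking 1 (Real.sqrt (2 / 3)) ⊆
          (fun p => L p + r₂) '' barlowStacking 1 (Real.sqrt (2 / 3)) σ') →
      TwoSlabLedgerWith K R₀ c₀ P₁ t₁ P₂ t₂) :
    BilayerWallBetaIIIAt c₀ (K + 60 * Real.sqrt 2 * Real.pi) R₀ :=
  fun _ _ hσ₁ hσ₂ hfcc L₁ L₂ s₁ s₂ _ _ _ _ hfr₁ hfr₂ _ _ _ hadm hnc _ =>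
    bilayerWallAt_bothFcc_nonCoaxial_of_ledgerWith hc₀ hR₀ hG hσ₁ hσ₂ hfcc L₁ L₂ s₁ s₂ hfr₁ hfr₂ hadm hnc

/-- **The `BothFcc` part of the registered residual at cap `c₀`** from the same ledger: a residual-class bilayer-frame pair is affinely,
hence linearly, non-co-axial. -/
theorem bilayerWallAt_bothFcc_residual_of_ledgerWith {c₀ K R₀ : ℝ} (hc₀ : 0 ≤ c₀) (hR₀ : 1 ≤ R₀)
    (hG : ∀ (P₁ : E3 ≃ₗᵢ[ℝ] E3) (t₁ : E3) (P₂ : E3 ≃ₗᵢ[ℝ] E3) (t₂ : E3),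
      ¬ (∃ (L : E3 ≃ₗᵢ[ℝ] E3) (r₁ r₂ : E3) (σ σ' : ℤ → ℤ), IsHaggSeq σ ∧ IsHaggSeq σ' ∧
        (fun p => P₁ p + t₁) '' fccStacking 1 (Real.sqrt (2 / 3)) ⊆
          (fun p => L p + r₁) '' barlowStacking 1 (Real.sqrt (2 / 3)) σ ∧
        (fun p => P₂ p + t₂) '' fccStacking 1 (Real.sqrt (2 / 3)) ⊆
          (fun p => L p + r₂) '' barlowStacking 1 (Real.sqrt (2 / 3)) σ') →
      TwoSlabLedgerWith K R₀ c₀ P₁ t₁ P₂ t₂)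
    {σ₁ σ₂ : ℤ → ℤ} (hσ₁ : IsHaggSeq σ₁) (hσ₂ : IsHaggSeq σ₂) (hfcc : BothFcc σ₁ σ₂)
    (L₁ L₂ : E3 ≃ₗᵢ[ℝ] E3) (s₁ s₂ : E3) {A₁ A₂ : ℤ → (E3 ≃ₗᵢ[ℝ] E3)} {u₁ u₂ : ℤ → E3}
    (hfr₁ : BilayerFramesAt L₁ s₁ σ₁ A₁ u₁) (hfr₂ : BilayerFramesAt L₂ s₂ σ₂ A₂ u₂)
    (hres : ∃ i j : ℤ, InResidualClass (A₁ i) (A₂ j) (u₁ i) (u₂ j))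
    {c : ℤ → ℤ → ℝ} {m : ℤ → ℤ → E3} (hadm : BilayerChargeAdmissibleAt c₀ A₁ A₂ c m) :
    BilayerWallAt (K + 60 * Real.sqrt 2 * Real.pi) R₀ σ₁ σ₂ L₁ L₂ s₁ s₂ c := by
  obtain ⟨i, j, hij⟩ := hres
  exact bilayerWallAt_bothFcc_nonCoaxial_of_ledgerWith hc₀ hR₀ hG hσ₁ hσ₂ hfcc L₁ L₂ s₁ s₂ hfr₁ hfr₂ hadm
    (i := i) (j := j) fun hco => hij.1 (affine_coax_of_coAx (u₁ i) (u₂ j) hco)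

open scoped Classical in
/-- **The whole `BothFcc` dispatcher at cap `c₀ ≤ 1` from F-U and lane G's charge-`c₀` ledger alone** (zero cell / F-U's matrix / `hG`;
no E1, no `StarPairFar`, no `hgen`, no priced-cell sort): every presented `BothFcc` pair with bilayer frames and a `c₀`-admissible table
satisfies the cell at `R₀ ≥ 3`. -/
theorem bilayerWallAt_of_bothFcc_ledgerWith {c₀ K R₀ C_F : ℝ} (hc₀ : 0 ≤ c₀) (hc₁ : c₀ ≤ 1) (hR₀ : 3 ≤ R₀)
    (hFU : CoaxialUnifAt C_F R₀)
    (hG : ∀ (P₁ : E3 ≃ₗᵢ[ℝ] E3) (t₁ : E3) (P₂ : E3 ≃ₗᵢ[ℝ] E3) (t₂ : E3),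
      ¬ (∃ (L : E3 ≃ₗᵢ[ℝ] E3) (r₁ r₂ : E3) (σ σ' : ℤ → ℤ), IsHaggSeq σ ∧ IsHaggSeq σ' ∧
        (fun p => P₁ p + t₁) '' fccStacking 1 (Real.sqrt (2 / 3)) ⊆
          (fun p => L p + r₁) '' barlowStacking 1 (Real.sqrt (2 / 3)) σ ∧
        (fun p => P₂ p + t₂) '' fccStacking 1 (Real.sqrt (2 / 3)) ⊆
          (fun p => L p + r₂) '' barlowStacking 1 (Real.sqrt (2 / 3)) σ') →
      TwoSlabLedgerWith K R₀ c₀ P₁ t₁ P₂ t₂)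
    {σ₁ σ₂ : ℤ → ℤ} (hσ₁ : IsHaggSeq σ₁) (hσ₂ : IsHaggSeq σ₂) (hfcc : BothFcc σ₁ σ₂)
    (L₁ L₂ : E3 ≃ₗᵢ[ℝ] E3) (s₁ s₂ : E3) {A₁ A₂ : ℤ → (E3 ≃ₗᵢ[ℝ] E3)} {u₁ u₂ : ℤ → E3}
    (hfr₁ : BilayerFramesAt L₁ s₁ σ₁ A₁ u₁) (hfr₂ : BilayerFramesAt L₂ s₂ σ₂ A₂ u₂)
    {c : ℤ → ℤ → ℝ} {m : ℤ → ℤ → E3} (hadm : BilayerChargeAdmissibleAt c₀ A₁ A₂ c m) :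
    BilayerWallAt (max (max (C_F + 60 * Real.sqrt 2 * Real.pi) ((3456 + 1152 * (R₀ + 1)) / 2)) (K + 60 * Real.sqrt 2 * Real.pi))
      R₀ σ₁ σ₂ L₁ L₂ s₁ s₂ c := by
  have hadm₁ : BilayerChargeAdmissible A₁ A₂ c m := bilayerChargeAdmissible_of_at hc₁ hadm
  obtain ⟨P₁, P₂, -, -, hS₁, hS₂⟩ := exists_affine_fcc_pair_of_bothFcc L₁ L₂ s₁ s₂ hσ₁ hσ₂ hfcc
  have hR0 : 0 ≤ R₀ := by linarith
  have hR1 : 1 ≤ R₀ := by linarith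
  by_cases hco : CoAx P₁ P₂
  · by_cases hlin : P₁ '' fccRef = P₂ '' fccRef
    · -- (α=) zero cell
      exact bilayerWallAt_mono hR0 (le_trans (le_max_right _ _) (le_max_left _ _))
        (bilayerWallAt_of_equal_linear hσ₁ hσ₂ hS₁ hS₂ hfr₁ hfr₂ hadm₁ hlin R₀ hR₀)
    · -- (α≠) lane F's uniform matrix
      obtain ⟨L, r₁, r₂, τ, τ', hτ, hτ', h₁, h₂, hcell⟩ :=
        hFU P₁ s₁ P₂ s₂ (affine_coax_of_coAx s₁ s₂ hco) (affine_ne_of_linear_ne hσ₁ hS₁ hlin)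
      exact bilayerWallAt_mono hR0 (le_trans (le_max_left _ _) (le_max_left _ _))
        (bilayerWallAt_of_coaxialCell hσ₁ hσ₂ hS₁ hS₂ hfr₁ hfr₂ hadm₁ hτ hτ' h₁ h₂ hR1 hcell)
  · -- (β) every non-co-axial pair, by lane G's charge-`c₀` ledger
    exact bilayerWallAt_mono hR0 (le_max_right _ _)
      (bilayerWallAt_of_ledgerWith_cap hS₁ hS₂ hc₀ hR1 hadm.1 hadm.2.1
        (hG P₁ s₁ P₂ s₂ fun h => hco (coAx_of_affine_coax h)))

/-! ## The same in lane G's deficiency currency `GenericWallFloorWithCharge` -/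

/-- **(β-iii) at cap `c₀` from lane G's uniform DEFICIENCY-form charge-`c₀` cell** (`GenericWallFloorWithCharge K R₀ c₀` for every
affinely non-co-axial pair; `R₀ ≥ 1`), through the absolute deficiency ⇒ adhesion converter `twoSlabLedgerWith_of_withCharge`. -/
theorem betaIIIAt_of_withCharge {c₀ K R₀ : ℝ} (hc₀ : 0 ≤ c₀) (hR₀ : 1 ≤ R₀)
    (hG : ∀ (P₁ : E3 ≃ₗᵢ[ℝ] E3) (t₁ : E3) (P₂ : E3 ≃ₗᵢ[ℝ] E3) (t₂ : E3),
      ¬ (∃ (L : E3 ≃ₗᵢ[ℝ] E3) (r₁ r₂ : E3) (σ σ' : ℤ → ℤ), IsHaggSeq σ ∧ IsHaggSeq σ' ∧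
        (fun p => P₁ p + t₁) '' fccStacking 1 (Real.sqrt (2 / 3)) ⊆
          (fun p => L p + r₁) '' barlowStacking 1 (Real.sqrt (2 / 3)) σ ∧
        (fun p => P₂ p + t₂) '' fccStacking 1 (Real.sqrt (2 / 3)) ⊆
          (fun p => L p + r₂) '' barlowStacking 1 (Real.sqrt (2 / 3)) σ') →
      GenericWallFloorWithCharge K R₀ c₀ P₁ t₁ P₂ t₂) :
    ∃ C : ℝ, BilayerWallBetaIIIAt c₀ C R₀ := by
  obtain ⟨K', -, hconv⟩ := twoSlabLedgerWith_of_withCharge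
  exact ⟨_, betaIIIAt_of_ledgerWith hc₀ hR₀ fun P₁ t₁ P₂ t₂ hnc => hconv hR₀ (hG P₁ t₁ P₂ t₂ hnc)⟩

/-- **The `BothFcc` part of the residual at cap `c₀` from the deficiency-form cell**, as a uniform statement with one constant. -/
theorem bothFccResidualAt_of_withCharge {c₀ K R₀ : ℝ} (hc₀ : 0 ≤ c₀) (hR₀ : 1 ≤ R₀)
    (hG : ∀ (P₁ : E3 ≃ₗᵢ[ℝ] E3) (t₁ : E3) (P₂ : E3 ≃ₗᵢ[ℝ] E3) (t₂ : E3),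
      ¬ (∃ (L : E3 ≃ₗᵢ[ℝ] E3) (r₁ r₂ : E3) (σ σ' : ℤ → ℤ), IsHaggSeq σ ∧ IsHaggSeq σ' ∧
        (fun p => P₁ p + t₁) '' fccStacking 1 (Real.sqrt (2 / 3)) ⊆
          (fun p => L p + r₁) '' barlowStacking 1 (Real.sqrt (2 / 3)) σ ∧
        (fun p => P₂ p + t₂) '' fccStacking 1 (Real.sqrt (2 / 3)) ⊆
          (fun p => L p + r₂) '' barlowStacking 1 (Real.sqrt (2 / 3)) σ') →
      GenericWallFloorWithCharge K R₀ c₀ P₁ t₁ P₂ t₂) :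
    ∃ C : ℝ, ∀ (σ₁ σ₂ : ℤ → ℤ), IsHaggSeq σ₁ → IsHaggSeq σ₂ → BothFcc σ₁ σ₂ →
      ∀ (L₁ L₂ : E3 ≃ₗᵢ[ℝ] E3) (s₁ s₂ : E3) (A₁ A₂ : ℤ → (E3 ≃ₗᵢ[ℝ] E3)) (u₁ u₂ : ℤ → E3),
      BilayerFramesAt L₁ s₁ σ₁ A₁ u₁ → BilayerFramesAt L₂ s₂ σ₂ A₂ u₂ →
      (∃ i j : ℤ, InResidualClass (A₁ i) (A₂ j) (u₁ i) (u₂ j)) →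
      ∀ (c : ℤ → ℤ → ℝ) (m : ℤ → ℤ → E3), BilayerChargeAdmissibleAt c₀ A₁ A₂ c m →
        BilayerWallAt C R₀ σ₁ σ₂ L₁ L₂ s₁ s₂ c := by
  obtain ⟨K', -, hconv⟩ := twoSlabLedgerWith_of_withCharge
  exact ⟨_, fun σ₁ σ₂ hσ₁ hσ₂ hfcc L₁ L₂ s₁ s₂ A₁ A₂ u₁ u₂ hfr₁ hfr₂ hres c m hadm =>
    bilayerWallAt_bothFcc_residual_of_ledgerWith hc₀ hR₀ (fun P₁ t₁ P₂ t₂ hnc => hconv hR₀ (hG P₁ t₁ P₂ t₂ hnc))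
      hσ₁ hσ₂ hfcc L₁ L₂ s₁ s₂ hfr₁ hfr₂ hres hadm⟩

end Summit.Ventures.Crystal3D.Cruxes.TextureLiminf.TexShadow

end
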